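import Summits.QuantumAdvantage.QuantumAdvantage.Theorems.SosSandwichQueryPathBridge
import Summits.QuantumAdvantage.QuantumAdvantage.Theorems.SosSandwichCircuitToQuery
import Summits.QuantumAdvantage.QuantumAdvantage.Theorems.SosSandwichQueryOneBitSurrogate
import HarnessLib

/-!
# Route `SosSandwich`: calibration of the live analytic crux `AA_Q` — it holds for boundedly many queries

After the circuit→query bridge (`Theorems/SosSandwichCircuitToQuery.lean`, `Theorems/SosSandwichQueryPathBridge.lean`)
the analytic crux of route SosSandwich is `AA_Q`: every `T ≥ 1`-query quantum acceptance polynomial with `Var ≥ ε > 0`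
has a variable of influence `≥ C (ε/T)^c`, constants UNIFORM in `T`.  This file pins in kernel what is unconditionally
known in the tree's model, so that the open content is located exactly:

* `aaQuery_expLoss` — the influence form of Aaronson–Ambainis' p. 6 remark: with the tree's PROVED
  Dinur–Friedgut–Kindler–O'Donnell bound (`dfko2007_influence_bounded_holds`), every quantum acceptance polynomial
  has a variable with `Inf_i ≥ ε^a / 2^{2 C T}` (`a, C` the DFKO constants) — an EXPONENTIAL loss in `T`;
* `aaQuery_of_queries_le` — consequently, for every `T₀`, `AA_Q` restricted to algorithms with `≤ T₀` queries HOLDS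
  (constants `(c, C') = (a, 2^{-2 C T₀})`): the open content of the crux is precisely the UNIFORMITY in `T`
  (polynomial versus exponential loss), not any fixed number of queries;
* `pathBound_expLoss` — the same bound transported to restrictions of oracle-circuit acceptance polynomials over any
  unitary gate set (through the landed bridge `CircuitToQuery.exists_queryAlg_acceptPoly` and `exists_alg_restrictPath`):
  `Inf_i ≥ ε^a / 2^{2 C · thm23Degree}` path-wise, UNCONDITIONALLY — what the random-oracle transfer can use today.

Honest label: calibration (corollaries of a proved Literature theorem); no stub, crux or summit is proved.
Sources: AaronsonAmbainis2014 p. 6 and Thm. 7; DinurEtAl2007 Thm. 3; BealsEtAl2001 Lemma 4.1.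
-/

noncomputable section

-- D-0017: single-conjunct summit ⇒ the duplicate `QuantumAdvantage.QuantumAdvantage` is mandated.
set_option linter.dupNamespace false

namespace Summit.QuantumAdvantage.QuantumAdvantage.Theorems.SosSandwich.QueryPathBridge

open Literature.Computability.Cryptography Literature.Computability.QuantumComplexity
open Summit.QuantumAdvantage.QuantumAdvantage.Cruxes.TransferPB.Birth

variable {N : ℕ}

/-- **`AA_Q` with exponential loss in the number of queries (unconditional).**  For the DFKO constants `a, C` of the
tree: every polynomial with the cube values of a `T`-query quantum algorithm and `Var ≥ ε > 0` has a variable with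
`ε^a / 2^{C·(2T)} ≤ Inf_i` (the acceptance polynomial `Σ q_j²` has degree `≤ 2T` and values in `[0,1]`; variance and
influences depend only on cube values; `T = 0` is vacuous since then the cube values are constant).
[cite: DinurEtAl2007, Thm. 3] [cite: AaronsonAmbainis2014, p. 6 and Thm. 7 (i)] -/
theorem aaQuery_expLoss :
    ∃ (a C : ℕ), ∀ (N : ℕ) (Q : QQueryAlg N) (p : MvPolynomial (Fin N) ℝ) (ε : ℝ),
      (∀ x, evalBool p x = Q.acceptProb x) → 0 < ε → ε ≤ boolVariance p →
        ∃ i : Fin N, ε ^ a / (2 : ℝ) ^ (C * (2 * Q.queries)) ≤ influence i p := by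
  obtain ⟨a, C, HD⟩ := dfko2007_influence_bounded_holds
  refine ⟨a, C, fun N Q p ε hp hε hv => ?_⟩
  rcases Nat.eq_zero_or_pos Q.queries with hT0 | hTpos
  · exfalso
    have h0 : boolVariance p = 0 := boolVariance_eq_zero_of_const p fun x y => by
      rw [hp, hp]; exact PBAAQuerySimulable.acceptProb_const_of_queries_eq_zero Q hT0 x y
    linarith
  obtain ⟨p₀, hpb, hdeg, hval⟩ := PBAAQuerySimulable.exists_pseudoBounded_acceptPoly Q
  have heq : evalBool p = evalBool p₀ := funext fun x => by rw [hp x, hval x]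
  have hv0 : ε ≤ boolVariance p₀ := by
    have : boolVariance p = boolVariance p₀ := by unfold boolVariance; rw [heq]
    rw [← this]; exact hv
  obtain ⟨i, hi⟩ := HD N (2 * Q.queries) p₀ ε (by omega) hdeg hpb.bounded hε hv0
  refine ⟨i, ?_⟩
  have hinf : influence i p = influence i p₀ := by unfold influence; rw [heq]
  rw [hinf]
  exact hi

/-- **`AA_Q` holds for boundedly many queries.**  For every `T₀` there are constants `c, C' > 0` (namely the DFKO
exponent `a` and `C' = 2^{-2 C T₀}`) such that every polynomial with the cube values of a quantum algorithm making
`1 ≤ T ≤ T₀` queries and `Var ≥ ε > 0` has a variable with `C' (ε/T)^c ≤ Inf_i` — the shape of `AA_Q` (hypothesis of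
`QueryRestrict.quantumQuerySimulable_of_aaQuery` / `pathBound_of_aaQuery_of_bridge`) on the sub-class `T ≤ T₀`.  So the
open content of the crux `AA_Q` is exactly the uniformity of the constants in `T`. [cite: DinurEtAl2007, Thm. 3]
[cite: AaronsonAmbainis2014, Conj. 6 and p. 6] -/
theorem aaQuery_of_queries_le (T₀ : ℕ) :
    ∃ (c : ℕ) (C' : ℝ), 0 < C' ∧ ∀ (N : ℕ) (Q : QQueryAlg N) (p : MvPolynomial (Fin N) ℝ) (ε : ℝ),
      Q.queries ≤ T₀ → 1 ≤ Q.queries → (∀ x, evalBool p x = Q.acceptProb x) → 0 < ε → ε ≤ boolVariance p →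
        ∃ i : Fin N, C' * (ε / Q.queries) ^ c ≤ influence i p := by
  obtain ⟨a, C, H⟩ := aaQuery_expLoss
  refine ⟨a, 1 / (2 : ℝ) ^ (C * (2 * T₀)), by positivity, fun N Q p ε hT₀ hT hp hε hv => ?_⟩
  obtain ⟨i, hi⟩ := H N Q p ε hp hε hv
  refine ⟨i, le_trans ?_ hi⟩
  have hTpos : (1 : ℝ) ≤ Q.queries := by exact_mod_cast hT
  have hεT : (ε / Q.queries) ^ a ≤ ε ^ a := by
    apply pow_le_pow_left₀ (div_nonneg hε.le (by positivity))
    exact div_le_self hε.le hTpos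
  have hpow : (2 : ℝ) ^ (C * (2 * Q.queries)) ≤ (2 : ℝ) ^ (C * (2 * T₀)) :=
    pow_le_pow_right₀ (by norm_num) (Nat.mul_le_mul_left C (Nat.mul_le_mul_left 2 hT₀))
  have h2pos : (0 : ℝ) < (2 : ℝ) ^ (C * (2 * Q.queries)) := by positivity
  calc 1 / (2 : ℝ) ^ (C * (2 * T₀)) * (ε / Q.queries) ^ a
      ≤ 1 / (2 : ℝ) ^ (C * (2 * Q.queries)) * ε ^ a := by
        apply mul_le_mul (one_div_le_one_div_of_le h2pos hpow) hεT (by positivity) (by positivity)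
    _ = ε ^ a / (2 : ℝ) ^ (C * (2 * Q.queries)) := by ring

/-- **The path-wise bound with exponential loss, UNCONDITIONALLY** (any unitary gate set).  For restrictions of
oracle-circuit acceptance polynomials: `ε^a / 2^{C·(2·thm23Degree F x)} ≤ Inf_i` for some `i` whenever `Var ≥ ε > 0` — the
landed bridge `CircuitToQuery.exists_queryAlg_acceptPoly` puts `acceptPoly F x` in `Q_T` with `T = #oracle gates ≤ thm23Degree`,
restrictions stay in `Q_T` (`exists_alg_restrictPath`), and `aaQuery_expLoss` applies.  This is what the random-oracle
transfer can use today: a `2^{O(#oracle gates)}` (not `poly`) classical query cost. [cite: DinurEtAl2007, Thm. 3]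
[cite: AaronsonAmbainis2014, Thm. 21 and p. 6] -/
theorem pathBound_expLoss {G : QGateSet} (hG : G.IsUnitary) :
    ∃ (a C : ℕ), ∀ (F : QCircuitFamily G) (x : List Bool)
      (ρ : List (Fin (numOracleBits F x) × Bool)) (ε : ℝ), 0 < ε →
      ε ≤ boolVariance (SimTreePB.restrictPath ρ (acceptPoly F x)) →
        ∃ i : Fin (numOracleBits F x),
          ε ^ a / (2 : ℝ) ^ (C * (2 * thm23Degree F x)) ≤ influence i (SimTreePB.restrictPath ρ (acceptPoly F x)) := by
  obtain ⟨a, C, H⟩ := aaQuery_expLoss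
  refine ⟨a, C, fun F x ρ ε hε hv => ?_⟩
  rcases Nat.eq_zero_or_pos (numOracleBits F x) with hN0 | hNpos
  · exfalso
    have h0 := boolVariance_eq_zero_of_eq_zero hN0 (SimTreePB.restrictPath ρ (acceptPoly F x))
    linarith
  obtain ⟨Q, hQq, hQacc⟩ := CircuitToQuery.exists_queryAlg_acceptPoly F x hG hNpos
  have hQdeg : Q.queries ≤ thm23Degree F x := by rw [hQq]; unfold thm23Degree; omega
  obtain ⟨Q', hq, hacc⟩ := exists_alg_restrictPath ρ Q (acceptPoly F x) hQacc
  obtain ⟨i, hi⟩ := H _ Q' _ ε hacc hε hv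
  refine ⟨i, le_trans ?_ hi⟩
  rw [hq]
  have hpow : (2 : ℝ) ^ (C * (2 * Q.queries)) ≤ (2 : ℝ) ^ (C * (2 * thm23Degree F x)) :=
    pow_le_pow_right₀ (by norm_num) (Nat.mul_le_mul_left C (Nat.mul_le_mul_left 2 hQdeg))
  exact div_le_div_of_nonneg_left (by positivity) (by positivity) hpow

/-- **Discharge of the inline hypothesis `Bridge`** of `pathBound_of_aaQuery_of_bridge` / `quantumAdvantage_of_aaQuery_of_bridge`
by the landed bridge (`CircuitToQuery.exists_queryAlg_acceptPoly`, Clifford+T is unitary): the conditional theorems of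
`Theorems/SosSandwichQueryPathBridge.lean` are now unconditional in the bridge (the sibling file
`Theorems/SosSandwichTransferPBQueryCrux.lean` states the same conclusions directly). [cite: AaronsonAmbainis2014, Thm. 23 (proof)] -/
theorem bridge_holds : ∀ (F : QCircuitFamily cliffordT) (x : List Bool), 0 < numOracleBits F x →
    ∃ Q : QQueryAlg (numOracleBits F x), Q.queries ≤ thm23Degree F x ∧
      ∀ b, Q.acceptProb b = evalBool (acceptPoly F x) b := fun F x hN => by
  obtain ⟨Q, hQq, hQacc⟩ := CircuitToQuery.exists_queryAlg_acceptPoly F x cliffordT_isUnitary_holds hN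
  exact ⟨Q, by rw [hQq]; unfold thm23Degree; omega, fun b => (hQacc b).symm⟩

/-- **The summit from `AA_Q`, via this lineage's conditional chain with the bridge discharged** (same statement as
`QueryCrux.quantumAdvantage_of_aaQuery`; recorded so that both halves of the split compose in the tree):
`AA_Q → RandomOracleHeurSeparation → PromiseLanguageLift → QuantumAdvantage`. [cite: AaronsonAmbainis2014, Thm. 7 (iii)] -/
theorem quantumAdvantage_of_aaQuery'
    (hAAQ : ∃ (c : ℕ) (C : ℝ), 0 < C ∧ ∀ (N : ℕ) (Q : QQueryAlg N) (p : MvPolynomial (Fin N) ℝ) (ε : ℝ),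
      1 ≤ Q.queries → (∀ x, evalBool p x = Q.acceptProb x) → 0 < ε → ε ≤ boolVariance p →
        ∃ i : Fin N, C * (ε / Q.queries) ^ c ≤ influence i p)
    (hX : Summit.QuantumAdvantage.QuantumAdvantage.Theses.SosSandwich.RandomOracleHeurSeparation)
    (hPL : Summit.QuantumAdvantage.QuantumAdvantage.Theses.SosSandwich.PromiseLanguageLift) : _root_.QuantumAdvantage :=
  quantumAdvantage_of_aaQuery_of_bridge bridge_holds hAAQ hX hPL

/-! ### Appended: the `Q_T` line's single stub is crux-EQUIVALENT, unconditionally -/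

/-- **`AA_Q ⟺ LevelDescent_Q`, unconditionally.**  The one open stub of the `Q_T` line — a variance-retaining,
influence-dominated surrogate that is one-query or top-homogeneous (`LevelDescent_Q`, right side) — is EQUIVALENT to the
crux `AA_Q` (left side): `→` is the one-bit one-query surrogate (`levelDescentQ_of_aaQuery`), `←` composes with the two
PROVED base rungs (`QueryTopLevel.aaQuery_of_levelDescentQ`: `OneQueryFrameAA_proof`, `queryHomogeneousRung` = Escudero
Gutiérrez Cor. 1.7).  So the `Q_T` line does not weaken the crux; it re-expresses it (the hypothesis `hH` of
`aaQuery_iff_levelDescentQ_of_homogeneousRungQ` is discharged). [cite: EscuderoGutierrez2023, Cor. 1.7 and Question 4.5]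
[cite: AaronsonAmbainis2014, Conj. 6] -/
theorem aaQuery_iff_levelDescentQ :
    (∃ (c : ℕ) (C : ℝ), 0 < C ∧ ∀ (N : ℕ) (Q : QQueryAlg N) (p : MvPolynomial (Fin N) ℝ) (ε : ℝ),
      1 ≤ Q.queries → (∀ x, evalBool p x = Q.acceptProb x) → 0 < ε → ε ≤ boolVariance p →
        ∃ i : Fin N, C * (ε / Q.queries) ^ c ≤ influence i p) ↔
    (∃ (a : ℕ) (A B : ℝ), 0 < A ∧ 0 < B ∧
      ∀ (N : ℕ) (Q : QQueryAlg N) (p : MvPolynomial (Fin N) ℝ) (ε : ℝ), 1 ≤ Q.queries →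
        (∀ x, evalBool p x = Q.acceptProb x) → 0 < ε → ε ≤ boolVariance p →
        ∃ (N' : ℕ) (Q' : QQueryAlg N') (q : MvPolynomial (Fin N') ℝ),
          1 ≤ Q'.queries ∧ Q'.queries ≤ Q.queries ∧ (∀ x, evalBool q x = Q'.acceptProb x) ∧
          (Q'.queries = 1 ∨ (∀ x : Fin N' → Bool,
            ∑ i : Fin N', (evalBool q x - evalBool q (Function.update x i (!x i))) =
              4 * (Q'.queries : ℝ) * (evalBool q x - boolAvg (evalBool q)))) ∧
          A * (ε / Q.queries) ^ a ≤ boolVariance q ∧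
          ∀ i : Fin N', ∃ i' : Fin N, influence i q ≤ B * influence i' p) :=
  ⟨levelDescentQ_of_aaQuery, QueryTopLevel.aaQuery_of_levelDescentQ⟩

/-- **The summit from the `Q_T` line and the summit from the crux are the same theorem** (bookkeeping for the planner's
re-lining): `LevelDescent_Q → X_ROG → PL → QuantumAdvantage`, via `aaQuery_iff_levelDescentQ` and this lineage's chain.
[cite: AaronsonAmbainis2014, Thm. 7 (iii)] -/
theorem quantumAdvantage_of_levelDescentQ'
    (hLD : ∃ (a : ℕ) (A B : ℝ), 0 < A ∧ 0 < B ∧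
      ∀ (N : ℕ) (Q : QQueryAlg N) (p : MvPolynomial (Fin N) ℝ) (ε : ℝ), 1 ≤ Q.queries →
        (∀ x, evalBool p x = Q.acceptProb x) → 0 < ε → ε ≤ boolVariance p →
        ∃ (N' : ℕ) (Q' : QQueryAlg N') (q : MvPolynomial (Fin N') ℝ),
          1 ≤ Q'.queries ∧ Q'.queries ≤ Q.queries ∧ (∀ x, evalBool q x = Q'.acceptProb x) ∧
          (Q'.queries = 1 ∨ (∀ x : Fin N' → Bool,
            ∑ i : Fin N', (evalBool q x - evalBool q (Function.update x i (!x i))) =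
              4 * (Q'.queries : ℝ) * (evalBool q x - boolAvg (evalBool q)))) ∧
          A * (ε / Q.queries) ^ a ≤ boolVariance q ∧
          ∀ i : Fin N', ∃ i' : Fin N, influence i q ≤ B * influence i' p)
    (hX : Summit.QuantumAdvantage.QuantumAdvantage.Theses.SosSandwich.RandomOracleHeurSeparation)
    (hPL : Summit.QuantumAdvantage.QuantumAdvantage.Theses.SosSandwich.PromiseLanguageLift) : _root_.QuantumAdvantage :=
  quantumAdvantage_of_aaQuery' (aaQuery_iff_levelDescentQ.2 hLD) hX hPL

end Summit.QuantumAdvantage.QuantumAdvantage.Theorems.SosSandwich.QueryPathBridge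

end
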